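import Summits.QuantumFields.BalabanUV.Beta.GAN24.LatticeFreeze
import Summits.QuantumFields.BalabanUV.Beta.GAN24.Push4TwoRate

/-!
# `BalabanUV.Beta.GAN24.EnvelopeBlockSum` — binder row G-an2-4 / (CONV-C), W-slot road «W3», ROW W3-F3b (T-irr) (gan24-p1-g5 `SKELETON-W3.md` v1.0.2
# §8.6 (F3-core-b); journal INTENT «W3-TIRR*» l.7944): THE GENERIC LATTICE TOOLKIT, part 2 — the block-label wobble of the (N1)-type envelope
# `E_z(u) := e^{−κ₀‖quo L u − z‖∞}` of `RespStepDecay` ∕ §8.6's LegEnv, and THE ONE FREE BLOCK SUM `Σ'_u Π_four E ≤ L^{d+1}·Z·e^{−(κ₀/6)·spread}`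

NOT IN PRINT; OUR PROOF ATTEMPT ([folklore] real analysis; 0 cited facts, 0 `def`, 0 `def … : Prop`, 0 wall binders).  HONEST FRAMING (cell contract,
verbatim): «discharging `BetaPertH` makes Bałaban's UV stability UNCONDITIONAL — a real constructive-QFT result; it is NOT the continuum limit and NOT the
Clay problem.»  HONEST DEPENDENCY (verbatim): «continuum YM on T⁴ ⇐ BetaPertH ∧ nine spine estimates (0/9 proved); BetaPertH ⇐ (D1) ∧ (D4) ∧ CAP+tail;
G-an2-4 gates asym, D1 and NE2/3/4.»  Discharges NOTHING of «T2Shape» ∕ «T2SupRate» ∕ (hW₂, hW₂all); NOT «W-slot closed», NEVER «G-an2-4 closed»;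
NOT `BetaPertH`, NOT continuum, NOT Clay.

## What is proved (`ℤ^{d+1}`, blocking `L ≥ 1`, rate `κ₀ ≥ 0`)
* §1 THE BLOCK-LABEL WOBBLE (floor division by `L ≥ 1` is 1-Lipschitz — leaf-03's `Push4TwoRate.abs_ediv_sub_ediv_le_abs_sub` BY NAME): `supNorm_quo_sub_quo_le_l1`
  (`‖quo L v − quo L u‖∞ ≤ |v − u|₁`), `supNorm_quo_sub_le_add_l1`, **`env_wobble`** (`E_z(v) ≤ e^{κ₀|v−u|₁}·E_z(u)`), `env_le_one`, `env_le_exp_l1`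
  (an `ℓ¹` majorant at rate `κ₀/((d+1)L)`, for summability only), `summable_env`.
* §2 `four_centres_le` (`Σ_four ‖c − ·‖∞ ≥ ½‖c − y‖∞ + ⅙(‖y′−y‖∞+‖x′−y‖∞+‖z′−y‖∞)`) and **`tsum_env4_le`** — THE ONE FREE BLOCK SUM:
  `Σ'_u E_y(u)·E_{y′}(u)·E_{x′}(u)·E_{z′}(u) ≤ L^{d+1}·Zl(κ₀/(2(d+1)))·e^{−(κ₀/6)(‖y′−y‖∞+‖x′−y‖∞+‖z′−y‖∞)}` (cell decomposition `u = L•c + b`,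
  `quo L (L•c + b) = c`): the `L^{d+1}` of SKELETON-W3 §7.3's marginal count, with the output decay of the composite push.
Unit `b2b-balaban-gan24-formalise-leaf-12` (G-an2-4 formalisation swarm, leaf prover 12, gen 20; ROW W3-F3b holder), 2026-08-20.
-/

noncomputable section

open Finset
open scoped BigOperators
open Literature.MathematicalPhysics.QuantumFieldTheory.LatticeForm (quo)
open Literature.MathematicalPhysics.QuantumFieldTheory.Balaban1983to89
open Literature.MathematicalPhysics.QuantumFieldTheory.Balaban1983to89.Beta
open B4ContourShift (supNorm abs_le_supNorm supNorm_nonneg exists_supNorm_eq)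
open B4Reflection242 (supNorm_le_of_forall supNorm_add_le)
open B12Sec2to5 (l1 l1_nonneg)
open ExpKernelCalculus (Zl Zl_nonneg Zl_pos summable_exp_shift summable_exp_shift' tsum_exp_shift tsum_exp_shift' l1_sub_triangle l1_sub_symm)
open AffineAveraging (box toSite)
open KKTFluctuationEnergy (quo_zsmul_add_toSite)
open Summit.QuantumFields.BalabanUV.Beta.GAN24.BiStencilZeroMode (tsum_eq_sum_box_tsum)

namespace Summit.QuantumFields.BalabanUV.Beta.GAN24.EnvelopeBlockSum

/-! ## §1 The block-label wobble of the (N1)-type envelope -/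

section Wobble

variable {d : ℕ}

/-- [folklore] Block labels move by at most the `ℓ¹` distance: `‖quo L v − quo L u‖∞ ≤ |v − u|₁` (`L ≥ 1`). -/
theorem supNorm_quo_sub_quo_le_l1 {L : ℕ} (hL : 1 ≤ L) (v u : Fin (d + 1) → ℤ) : supNorm (quo L v - quo L u) ≤ l1 (v - u) := by
  refine supNorm_le_of_forall fun i => ?_
  have h1 : |(quo L v - quo L u) i| ≤ |(v - u) i| := by
    simp only [Pi.sub_apply, quo]
    exact Push4TwoRate.abs_ediv_sub_ediv_le_abs_sub hL (v i) (u i)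
  have h2 : (((|(v - u) i| : ℤ) : ℝ)) ≤ l1 (v - u) := by
    unfold l1
    rw [Int.cast_abs]
    exact Finset.single_le_sum (f := fun μ => |((v - u) μ : ℝ)|) (fun μ _ => abs_nonneg _) (Finset.mem_univ i)
  exact (Int.cast_le.2 h1).trans h2

/-- [folklore] `‖quo L u − z‖∞ ≤ ‖quo L v − z‖∞ + |v − u|₁`. -/
theorem supNorm_quo_sub_le_add_l1 {L : ℕ} (hL : 1 ≤ L) (u v z : Fin (d + 1) → ℤ) :
    supNorm (quo L u - z) ≤ supNorm (quo L v - z) + l1 (v - u) := by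
  have h := supNorm_add_le (quo L v - z) (quo L u - quo L v)
  rw [show quo L v - z + (quo L u - quo L v) = quo L u - z by abel] at h
  have h2 := supNorm_quo_sub_quo_le_l1 (d := d) hL u v
  rw [l1_sub_symm] at h2
  linarith

/-- [folklore] **THE WOBBLE**: `e^{−κ₀‖quo L v − z‖∞} ≤ e^{κ₀|v − u|₁}·e^{−κ₀‖quo L u − z‖∞}` (`κ₀ ≥ 0`, `L ≥ 1`). -/
theorem env_wobble {L : ℕ} (hL : 1 ≤ L) {κ₀ : ℝ} (hκ : 0 ≤ κ₀) (z u v : Fin (d + 1) → ℤ) :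
    Real.exp (-(κ₀ * supNorm (quo L v - z))) ≤ Real.exp (κ₀ * l1 (v - u)) * Real.exp (-(κ₀ * supNorm (quo L u - z))) := by
  rw [← Real.exp_add, Real.exp_le_exp]
  have h := supNorm_quo_sub_le_add_l1 (d := d) hL u v z
  nlinarith

/-- [folklore] The envelope is at most `1`. -/
theorem env_le_one {L : ℕ} {κ₀ : ℝ} (hκ : 0 ≤ κ₀) (z u : Fin (d + 1) → ℤ) : Real.exp (-(κ₀ * supNorm (quo L u - z))) ≤ 1 := by
  rw [Real.exp_le_one_iff]; have := supNorm_nonneg (quo L u - z); nlinarith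

/-- [folklore] An `ℓ¹` majorant of the envelope (for summability only): `e^{−κ₀‖quo L u − z‖∞} ≤ e^{κ₀}·e^{−(κ₀/((d+1)·L))·|u − L•z|₁}`. -/
theorem env_le_exp_l1 {L : ℕ} (hL : 1 ≤ L) {κ₀ : ℝ} (hκ : 0 ≤ κ₀) (z u : Fin (d + 1) → ℤ) :
    Real.exp (-(κ₀ * supNorm (quo L u - z))) ≤
      Real.exp κ₀ * Real.exp (-(κ₀ / (((d : ℝ) + 1) * L)) * l1 (u - (L : ℤ) • z)) := by
  have hL0 : (0 : ℝ) < L := by exact_mod_cast hL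
  have hD : (0 : ℝ) < (d : ℝ) + 1 := by positivity
  -- coordinatewise: `|u_i − L z_i| ≤ L·(|quo L u i − z i| + 1)`
  have hcoord : ∀ i, |((u - (L : ℤ) • z) i : ℝ)| ≤ (L : ℝ) * (supNorm (quo L u - z) + 1) := by
    intro i
    have hq : (((|(quo L u - z) i| : ℤ) : ℝ)) ≤ supNorm (quo L u - z) := abs_le_supNorm _ i
    have hdiv : u i = (L : ℤ) * (u i / (L : ℤ)) + u i % (L : ℤ) := (Int.mul_ediv_add_emod _ _).symm
    have hr0 : 0 ≤ u i % (L : ℤ) := Int.emod_nonneg _ (by exact_mod_cast (by omega : L ≠ 0))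
    have hrL : u i % (L : ℤ) < L := Int.emod_lt_of_pos _ (by exact_mod_cast hL)
    have key : |(u - (L : ℤ) • z) i| ≤ (L : ℤ) * (|(quo L u - z) i| + 1) := by
      simp only [Pi.sub_apply, Pi.smul_apply, smul_eq_mul, quo]
      rw [abs_le]
      constructor <;> nlinarith [abs_le.1 (le_refl |u i / (L:ℤ) - z i|), le_abs_self (u i / (L:ℤ) - z i), neg_abs_le (u i / (L:ℤ) - z i)]
    have key' : (((|(u - (L : ℤ) • z) i| : ℤ) : ℝ)) ≤ (L : ℝ) * ((((|(quo L u - z) i| : ℤ) : ℝ)) + 1) := by exact_mod_cast key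
    have hq' : (L : ℝ) * ((((|(quo L u - z) i| : ℤ) : ℝ)) + 1) ≤ (L : ℝ) * (supNorm (quo L u - z) + 1) :=
      mul_le_mul_of_nonneg_left (by linarith) hL0.le
    have := key'.trans hq'
    rwa [Int.cast_abs] at this
  have hl1 : l1 (u - (L : ℤ) • z) ≤ ((d : ℝ) + 1) * L * (supNorm (quo L u - z) + 1) := by
    unfold l1
    calc ∑ μ, |(((u - (L : ℤ) • z) μ : ℤ) : ℝ)| ≤ ∑ _μ : Fin (d + 1), (L : ℝ) * (supNorm (quo L u - z) + 1) :=
          Finset.sum_le_sum fun i _ => hcoord i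
      _ = ((d : ℝ) + 1) * L * (supNorm (quo L u - z) + 1) := by
          rw [Finset.sum_const, Finset.card_univ, Fintype.card_fin, nsmul_eq_mul]; push_cast; ring
  rw [← Real.exp_add, Real.exp_le_exp]
  have e : κ₀ / (((d : ℝ) + 1) * L) * (((d : ℝ) + 1) * L * (supNorm (quo L u - z) + 1)) = κ₀ * (supNorm (quo L u - z) + 1) := by
    field_simp
  have hk : 0 ≤ κ₀ / (((d : ℝ) + 1) * L) := by positivity
  nlinarith [mul_le_mul_of_nonneg_left hl1 hk]

/-- [folklore] The envelope is summable over the fine lattice. -/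
theorem summable_env {L : ℕ} (hL : 1 ≤ L) {κ₀ : ℝ} (hκ : 0 < κ₀) (z : Fin (d + 1) → ℤ) :
    Summable fun u : Fin (d + 1) → ℤ => Real.exp (-(κ₀ * supNorm (quo L u - z))) := by
  have hL0 : (0 : ℝ) < L := by exact_mod_cast hL
  have hr : 0 < κ₀ / (((d : ℝ) + 1) * L) := by positivity
  refine Summable.of_norm_bounded ((summable_exp_shift' hr ((L : ℤ) • z)).mul_left (Real.exp κ₀)) (fun u => ?_)
  rw [Real.norm_eq_abs, abs_of_pos (Real.exp_pos _)]
  exact env_le_exp_l1 hL hκ.le z u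

end Wobble

/-! ## §2 The one free block sum -/

section BlockSum

variable {d : ℕ}

/-- [folklore] Geometry of four sup-distances: `‖c−y‖ + ‖c−y′‖ + ‖c−x′‖ + ‖c−z′‖ ≥ ½‖c−y‖ + ⅙(‖y′−y‖ + ‖x′−y‖ + ‖z′−y‖)` (sup norms). -/
theorem four_centres_le (c y y' x' z' : Fin (d + 1) → ℤ) :
    supNorm (c - y) / 2 + (supNorm (y' - y) + supNorm (x' - y) + supNorm (z' - y)) / 6 ≤
      supNorm (c - y) + supNorm (c - y') + supNorm (c - x') + supNorm (c - z') := by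
  have hneg : ∀ x : Fin (d + 1) → ℤ, supNorm (-x) = supNorm x := fun x => by
    unfold supNorm; congr 1; funext i; simp only [Pi.neg_apply, abs_neg]
  have tri : ∀ p q : Fin (d + 1) → ℤ, supNorm (p - q) ≤ supNorm (c - q) + supNorm (c - p) := fun p q => by
    have h := supNorm_add_le (c - q) (-(c - p))
    rw [show c - q + -(c - p) = p - q by abel, hneg] at h
    exact h
  have t1 := tri y' y
  have t2 := tri x' y
  have t3 := tri z' y
  have h0 := supNorm_nonneg (c - y)
  have h1 := supNorm_nonneg (c - y'); have h2 := supNorm_nonneg (c - x'); have h3 := supNorm_nonneg (c - z')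
  linarith

/-- [folklore] **THE ONE FREE BLOCK SUM**: `Σ'_u E_y(u)·E_{y′}(u)·E_{x′}(u)·E_{z′}(u) ≤ L^{d+1}·Zl(κ₀/(2(d+1)))·e^{−(κ₀/6)(‖y′−y‖∞+‖x′−y‖∞+‖z′−y‖∞)}`
for the (N1)-type envelope `E_z(u) = e^{−κ₀‖quo L u − z‖∞}` — the `L^{d+1}` points of each `L`-cell share their label `c = quo L u`, and the four
labels' spread controls both the `c`-sum and the output decay. -/
theorem tsum_env4_le {L : ℕ} (hL : 1 ≤ L) {κ₀ : ℝ} (hκ : 0 < κ₀) (y y' x' z' : Fin (d + 1) → ℤ) :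
    (Summable fun u : Fin (d + 1) → ℤ => Real.exp (-(κ₀ * supNorm (quo L u - y))) * Real.exp (-(κ₀ * supNorm (quo L u - y'))) *
        Real.exp (-(κ₀ * supNorm (quo L u - x'))) * Real.exp (-(κ₀ * supNorm (quo L u - z')))) ∧
    ∑' u : Fin (d + 1) → ℤ, Real.exp (-(κ₀ * supNorm (quo L u - y))) * Real.exp (-(κ₀ * supNorm (quo L u - y'))) *
        Real.exp (-(κ₀ * supNorm (quo L u - x'))) * Real.exp (-(κ₀ * supNorm (quo L u - z')))
      ≤ (L : ℝ) ^ (d + 1) * Zl (d + 1) (κ₀ / (2 * ((d : ℝ) + 1))) *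
          Real.exp (-(κ₀ / 6) * (supNorm (y' - y) + supNorm (x' - y) + supNorm (z' - y))) := by
  haveI : NeZero L := ⟨by omega⟩
  set F : (Fin (d + 1) → ℤ) → ℝ := fun u => Real.exp (-(κ₀ * supNorm (quo L u - y))) * Real.exp (-(κ₀ * supNorm (quo L u - y'))) *
        Real.exp (-(κ₀ * supNorm (quo L u - x'))) * Real.exp (-(κ₀ * supNorm (quo L u - z'))) with hF
  -- summability: dominated by the first factor
  have hFle : ∀ u, |F u| ≤ Real.exp (-(κ₀ * supNorm (quo L u - y))) := by
    intro u
    rw [hF]; dsimp only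
    rw [abs_of_pos (by positivity)]
    have h1 := env_le_one (L := L) hκ.le y' u
    have h2 := env_le_one (L := L) hκ.le x' u
    have h3 := env_le_one (L := L) hκ.le z' u
    have h0 : 0 ≤ Real.exp (-(κ₀ * supNorm (quo L u - y))) := (Real.exp_pos _).le
    calc _ ≤ Real.exp (-(κ₀ * supNorm (quo L u - y))) * 1 * 1 * 1 := by gcongr
      _ = _ := by ring
  have hFs : Summable F := Summable.of_norm_bounded (summable_env hL hκ y) (fun u => by rw [Real.norm_eq_abs]; exact hFle u)
  refine ⟨hFs, ?_⟩
  -- cell decomposition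
  rw [tsum_eq_sum_box_tsum (N := L) hFs]
  have hcell : ∀ b ∈ box (d + 1) L, ∀ c : Fin (d + 1) → ℤ,
      F ((L : ℤ) • c + toSite b) = Real.exp (-(κ₀ * (supNorm (c - y) + supNorm (c - y') + supNorm (c - x') + supNorm (c - z')))) := by
    intro b hb c
    rw [hF]; dsimp only
    rw [quo_zsmul_add_toSite c hb, ← Real.exp_add, ← Real.exp_add, ← Real.exp_add]
    congr 1; ring
  have hD : (0 : ℝ) < (d : ℝ) + 1 := by positivity
  set S₃ : ℝ := supNorm (y' - y) + supNorm (x' - y) + supNorm (z' - y) with hS₃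
  -- the `c`-sum of each cell
  have hc_bound : ∀ c : Fin (d + 1) → ℤ,
      Real.exp (-(κ₀ * (supNorm (c - y) + supNorm (c - y') + supNorm (c - x') + supNorm (c - z'))))
        ≤ Real.exp (-(κ₀ / 6) * S₃) * Real.exp (-(κ₀ / (2 * ((d : ℝ) + 1))) * l1 (c - y)) := by
    intro c
    rw [← Real.exp_add, Real.exp_le_exp]
    have h4 := four_centres_le c y y' x' z'
    have hl : l1 (c - y) ≤ ((d : ℝ) + 1) * supNorm (c - y) := by
      unfold l1
      calc ∑ μ, |(((c - y) μ : ℤ) : ℝ)| ≤ ∑ _μ : Fin (d + 1), supNorm (c - y) := Finset.sum_le_sum fun i _ => by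
              have h := abs_le_supNorm (c - y) i
              rwa [Int.cast_abs] at h
        _ = ((d : ℝ) + 1) * supNorm (c - y) := by
              rw [Finset.sum_const, Finset.card_univ, Fintype.card_fin, nsmul_eq_mul]; push_cast; ring
    have e : κ₀ / (2 * ((d : ℝ) + 1)) * (((d : ℝ) + 1) * supNorm (c - y)) = κ₀ * (supNorm (c - y) / 2) := by
      field_simp
    have hk : 0 ≤ κ₀ / (2 * ((d : ℝ) + 1)) := by positivity
    nlinarith [mul_le_mul_of_nonneg_left hl hk]
  have hcs : ∀ c : Fin (d + 1) → ℤ, Summable fun c : Fin (d + 1) → ℤ =>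
      Real.exp (-(κ₀ * (supNorm (c - y) + supNorm (c - y') + supNorm (c - x') + supNorm (c - z')))) := fun _ =>
    Summable.of_norm_bounded ((summable_exp_shift' (c := κ₀ / (2 * ((d : ℝ) + 1))) (by positivity) y).mul_left
      (Real.exp (-(κ₀ / 6) * S₃))) (fun c => by
      rw [Real.norm_eq_abs, abs_of_pos (Real.exp_pos _)]; exact hc_bound c)
  have hsum_c : (∑' c : Fin (d + 1) → ℤ,
      Real.exp (-(κ₀ * (supNorm (c - y) + supNorm (c - y') + supNorm (c - x') + supNorm (c - z')))))
        ≤ Real.exp (-(κ₀ / 6) * S₃) * Zl (d + 1) (κ₀ / (2 * ((d : ℝ) + 1))) := by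
    have h := Summable.tsum_le_tsum hc_bound (hcs 0)
      ((summable_exp_shift' (c := κ₀ / (2 * ((d : ℝ) + 1))) (by positivity) y).mul_left _)
    refine h.trans (le_of_eq ?_)
    rw [tsum_mul_left, tsum_exp_shift']
  have hcard : ((box (d + 1) L).card : ℝ) = (L : ℝ) ^ (d + 1) := by
    unfold AffineAveraging.box
    rw [Fintype.card_piFinset, Finset.prod_const, Finset.card_range, Finset.card_univ, Fintype.card_fin]
    push_cast
    rfl
  calc ∑ b ∈ box (d + 1) L, ∑' c : Fin (d + 1) → ℤ, F ((L : ℤ) • c + toSite b)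
      = ∑ b ∈ box (d + 1) L, ∑' c : Fin (d + 1) → ℤ,
          Real.exp (-(κ₀ * (supNorm (c - y) + supNorm (c - y') + supNorm (c - x') + supNorm (c - z')))) :=
        Finset.sum_congr rfl fun b hb => tsum_congr fun c => hcell b hb c
    _ ≤ ∑ _b ∈ box (d + 1) L, Real.exp (-(κ₀ / 6) * S₃) * Zl (d + 1) (κ₀ / (2 * ((d : ℝ) + 1))) :=
        Finset.sum_le_sum fun b _ => hsum_c
    _ = (L : ℝ) ^ (d + 1) * Zl (d + 1) (κ₀ / (2 * ((d : ℝ) + 1))) * Real.exp (-(κ₀ / 6) * S₃) := by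
        rw [Finset.sum_const, nsmul_eq_mul, hcard]; ring

end BlockSum

end Summit.QuantumFields.BalabanUV.Beta.GAN24.EnvelopeBlockSum

end
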